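import Literature.NumberTheory.EllipticCurves.IwasawaAlgebraSpecializationLambdaProofs
import HarnessLib

/-!
# The `λ`-transfer at a height-one prime `(f)`: `#(N ⧸ Q_m N) ≍ p^{m · deg f · ℓ_f(N)}` and
# «uniform `#(N ⧸ Q_m N) ≤ p^C · #(N' ⧸ Q_m N')^k` ⟹ `ℓ_f(N) ≤ k · ℓ_f(N')`» (proofs file)

Topic `NumberTheory/EllipticCurves`. THEOREMS ONLY (no definition, no named fact, no `sorry`). Continuation of
`IwasawaAlgebraSpecializationLambdaProofs` (Howard's `λ`-primes `Q_m = f + p^m` for a distinguished irreducible `f`,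
the exact count of the elementary module modulo `Q_m`, `ℓ_f(E(μs, fs)) = Σ_{f ∣ gⱼ} nⱼ`): here the structure theorem
(`exists_isPseudoIsomorphism_elementary_holds`) and the index comparison along a pseudo-isomorphism
(`LinearMap.IsPseudoIsomorphism.exists_card_quotient_le`) transport them to an arbitrary finitely generated torsion
`Λ`-module `N`, giving the `λ`-twin of `IwasawaAlgebraSpecializationIndexProofs.exists_card_quotSMulTop_qm_bounds` /
`….muInvariant_le_two_mul_of_card_quotSMulTop_qm_le` (the `μ`-primes `T^m + p`): Howard's device for reading the
`(f)`-part of `char(N) ∣ char(N')^k` off specialised indices ([Howard 2004] proof of Thm. 2.2.10; [Mazur–Rubin 2004]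
§5.3, proof of Thm. 5.3.10). Lead seat of line `birth`, crux K1 stmt-BirchSwinnertonDyer-24198 (research child
A = stmt-26896). HONEST FRAMING: pure `Λ`-module algebra; nothing arithmetic; BSD is not proved by any of this.

* `lengthAt_ne_top_of_isTorsion_of_height_le_one` — local lengths of f.g. torsion modules are finite at height `≤ 1`.
* **`exists_card_quotSMulTop_add_C_pow_bounds`** — for `N` f.g. torsion and `f` distinguished irreducible there are
  `B ≥ 1`, `m₁` with: for all `m ≥ m₁`, `N ⧸ Q_m N` is finite, `p^{m · deg f · ℓ} ≤ B · #(N ⧸ Q_m N)` and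
  `#(N ⧸ Q_m N) ≤ B · p^{m · deg f · ℓ}`, `ℓ = length_{Λ_(f)} N_(f)`.
* **`lengthAt_le_mul_of_card_quotSMulTop_add_C_pow_le`** — if `#(N ⧸ Q_m N) ≤ p^C · #(N' ⧸ Q_m N')^k` for all
  `m ≥ m₀`, then `length_{Λ_(f)} N_(f) ≤ k · length_{Λ_(f)} N'_(f)`.

References: [Howard2004HeegnerKolyvagin] proof of Thm. 2.2.10; [MazurRubin2004] §5.3 (proof of Thm. 5.3.10);
[Washington1997] §13.2 (Thm. 13.12).
-/

set_option autoImplicit false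

noncomputable section

open scoped Classical Pointwise Polynomial DirectSum

namespace Literature.NumberTheory.EllipticCurves

namespace IwasawaAlgebra

variable (p : ℕ) [Fact p.Prime]

/-- Local lengths of a finitely generated torsion `Λ`-module are finite at every prime of height `≤ 1`
(the module is killed by a non-zero-divisor). [cite: Washington1997, §13.2] -/
theorem lengthAt_ne_top_of_isTorsion_of_height_le_one (N : Type*) [AddCommGroup N]
    [Module (IwasawaAlgebra p) N] [Module.Finite (IwasawaAlgebra p) N]
    (hN : Module.IsTorsion (IwasawaAlgebra p) N) (𝔭 : PrimeSpectrum (IwasawaAlgebra p))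
    (h𝔭 : 𝔭.asIdeal.height ≤ 1) : Module.lengthAt (IwasawaAlgebra p) N 𝔭 ≠ ⊤ := by
  obtain ⟨s, hs, hs0⟩ := Submodule.annihilator_top_inter_nonZeroDivisors hN
  exact Module.lengthAt_ne_top_of_isTorsionBy (nonZeroDivisors.ne_zero hs0)
    (fun m => Submodule.mem_annihilator.mp hs m Submodule.mem_top) 𝔭 h𝔭

/-- **Specialised-index asymptotics at the `λ`-primes `Q_m = f + p^m`** (`f` distinguished irreducible of degree
`d`): for a finitely generated torsion `Λ`-module `N` there are `B ≥ 1` and `m₁` such that for every `m ≥ m₁` the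
quotient `N ⧸ Q_m N` is finite and `p^{m d ℓ} ≤ B · #(N ⧸ Q_m N)`, `#(N ⧸ Q_m N) ≤ B · p^{m d ℓ}` with
`ℓ = length_{Λ_(f)} N_(f)` the exponent of `(f)` in `char N` (structure theorem up to a pseudo-isomorphism
`θ : N → E(μs, fs)`, exact count of `E ⧸ Q_m E`, `ℓ_f(E) = ℓ_f(N)`, index comparison along `θ`).
[cite: Howard2004HeegnerKolyvagin, proof of Thm. 2.2.10 (the primes f + p^m)] [cite: Washington1997, §13.2 (Thm. 13.12)] -/
theorem exists_card_quotSMulTop_add_C_pow_bounds (N : Type*) [AddCommGroup N] [Module (IwasawaAlgebra p) N]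
    [Module.Finite (IwasawaAlgebra p) N] (hN : Module.IsTorsion (IwasawaAlgebra p) N)
    {f : ℤ_[p][X]} (hf : f.IsDistinguishedAt (IsLocalRing.maximalIdeal ℤ_[p])) (hirr : Irreducible f)
    (𝔭 : PrimeSpectrum (IwasawaAlgebra p)) (h𝔭 : 𝔭.asIdeal = Ideal.span {(f : IwasawaAlgebra p)}) :
    ∃ B m₁ : ℕ, 0 < B ∧ ∀ m : ℕ, m₁ ≤ m →
      Finite (N ⧸ (Ideal.span {(f : IwasawaAlgebra p) + PowerSeries.C ((p : ℤ_[p]) ^ m)} • ⊤ :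
        Submodule (IwasawaAlgebra p) N)) ∧
      p ^ (m * (f.natDegree * (Module.lengthAt (IwasawaAlgebra p) N 𝔭).toNat)) ≤
        B * Nat.card (N ⧸ (Ideal.span {(f : IwasawaAlgebra p) + PowerSeries.C ((p : ℤ_[p]) ^ m)} • ⊤ :
          Submodule (IwasawaAlgebra p) N)) ∧
      Nat.card (N ⧸ (Ideal.span {(f : IwasawaAlgebra p) + PowerSeries.C ((p : ℤ_[p]) ^ m)} • ⊤ :
          Submodule (IwasawaAlgebra p) N)) ≤
        B * p ^ (m * (f.natDegree * (Module.lengthAt (IwasawaAlgebra p) N 𝔭).toNat)) := by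
  classical
  have hp : p.Prime := Fact.out
  obtain ⟨μs, fs, -, hfs, θ, hθ⟩ := exists_isPseudoIsomorphism_elementary_holds p N hN
  have hfs' : ∀ g ∈ fs, g.1.IsDistinguishedAt (IsLocalRing.maximalIdeal ℤ_[p]) ∧ Irreducible g.1 :=
    fun g hg => ⟨(hfs g hg).1, (hfs g hg).2.1⟩
  set E := elementaryModule p μs fs with hEdef
  haveI : Module.Finite (IwasawaAlgebra p) E := moduleFinite_elementaryModule p μs fs
  haveI : IsNoetherian (IwasawaAlgebra p) N := isNoetherian_of_isNoetherianRing_of_finite _ _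
  haveI : Finite (LinearMap.ker θ) := finite_of_isPseudoNull p (LinearMap.ker θ) hθ.1
  haveI : Finite (E ⧸ LinearMap.range θ) := finite_of_isPseudoNull p (E ⧸ LinearMap.range θ) hθ.2
  obtain ⟨B, hB, hcmp⟩ := hθ.exists_card_quotient_le p
  obtain ⟨C, m₁, hC, hcount⟩ := exists_card_elementaryModule_quotSMulTop_add_C_pow p hf hirr (μs := μs) hfs'
  -- the exponent: `ℓ_f(N) = ℓ_f(E) = e(E)`
  set e : ℕ := (fs.map fun g => if (f : IwasawaAlgebra p) ∣ (g.1 : IwasawaAlgebra p) then g.2 else 0).sum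
    with hedef
  have h1 : 𝔭.asIdeal.height = 1 := by
    rw [h𝔭]; exact Module.height_span_singleton_eq_one_of_prime (prime_coe_of_irreducible p hf hirr)
  have hℓ : (Module.lengthAt (IwasawaAlgebra p) N 𝔭).toNat = e := by
    rw [Module.lengthAt_eq_of_isPseudoIsomorphism hθ 𝔭 h1.le, lengthAt_elementaryModule_span_coe p hf hirr hfs' 𝔭 h𝔭,
      ENat.toNat_coe]
  refine ⟨B * C, m₁, Nat.mul_pos hB hC, fun m hm => ?_⟩
  set q : IwasawaAlgebra p := (f : IwasawaAlgebra p) + PowerSeries.C ((p : ℤ_[p]) ^ m) with hqdef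
  have hE : Nat.card (E ⧸ (Ideal.span {q} • ⊤ : Submodule (IwasawaAlgebra p) E)) = C * p ^ (m * (f.natDegree * e)) :=
    hcount m hm
  have hEfin : Finite (E ⧸ (Ideal.span {q} • ⊤ : Submodule (IwasawaAlgebra p) E)) :=
    Nat.finite_of_card_ne_zero (by rw [hE]; exact (Nat.mul_pos hC (pow_pos hp.pos _)).ne')
  have hEfin' : Finite (E ⧸ (q • ⊤ : Submodule (IwasawaAlgebra p) E)) :=
    Finite.of_equiv _ (Submodule.quotEquivOfEq _ _ (Submodule.ideal_span_singleton_smul q ⊤)).toEquiv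
  have hNfin' : Finite (N ⧸ (q • ⊤ : Submodule (IwasawaAlgebra p) N)) :=
    (LinearMap.finite_quotient_smul_top_iff_of_finite_ker_coker θ q).mpr hEfin'
  have hNfin : Finite (N ⧸ (Ideal.span {q} • ⊤ : Submodule (IwasawaAlgebra p) N)) :=
    Finite.of_equiv _ (Submodule.quotEquivOfEq _ _ (Submodule.ideal_span_singleton_smul q ⊤)).toEquiv.symm
  obtain ⟨hle1, hle2⟩ := hcmp q
  refine ⟨hNfin, ?_, ?_⟩
  · rw [hℓ]
    calc p ^ (m * (f.natDegree * e)) ≤ C * p ^ (m * (f.natDegree * e)) := Nat.le_mul_of_pos_left _ hC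
      _ = Nat.card (E ⧸ (Ideal.span {q} • ⊤ : Submodule (IwasawaAlgebra p) E)) := hE.symm
      _ ≤ B * Nat.card (N ⧸ (Ideal.span {q} • ⊤ : Submodule (IwasawaAlgebra p) N)) := hle2
      _ ≤ B * C * Nat.card (N ⧸ (Ideal.span {q} • ⊤ : Submodule (IwasawaAlgebra p) N)) :=
          Nat.mul_le_mul_right _ (Nat.le_mul_of_pos_right _ hC)
  · rw [hℓ]
    calc Nat.card (N ⧸ (Ideal.span {q} • ⊤ : Submodule (IwasawaAlgebra p) N))
          ≤ B * Nat.card (E ⧸ (Ideal.span {q} • ⊤ : Submodule (IwasawaAlgebra p) E)) := hle1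
      _ = B * C * p ^ (m * (f.natDegree * e)) := by rw [hE, mul_assoc]

/-- **λ-TRANSFER: a specialised index inequality, uniform in `m`, gives the `λ`-inequality at `(f)`.** For finitely
generated torsion `Λ`-modules `N, N'` and a distinguished irreducible `f`: if `#(N ⧸ Q_m N) ≤ p^C · #(N' ⧸ Q_m N')^k`
for all `m ≥ m₀` (`Q_m = f + p^m`), then `length_{Λ_(f)} N_(f) ≤ k · length_{Λ_(f)} N'_(f)` — the exponent of `(f)`
in `char N` is at most `k` times that in `char N'` (asymptotics `p^{m d ℓ} ≤ const · p^{m d k ℓ'}`,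
`le_of_forall_pow_mul_le`, `d ≥ 1`). With the `μ`-twin (`muInvariant_le_two_mul_of_card_quotSMulTop_qm_le`, `k = 2`)
this is Howard's reading of `char(X) ∣ char(Y)^2` from uniform specialised Kolyvagin-system bounds.
[cite: Howard2004HeegnerKolyvagin, proof of Thm. 2.2.10] [cite: MazurRubin2004, §5.3 (proof of Thm. 5.3.10)] -/
theorem lengthAt_le_mul_of_card_quotSMulTop_add_C_pow_le (N N' : Type*) [AddCommGroup N]
    [Module (IwasawaAlgebra p) N] [AddCommGroup N'] [Module (IwasawaAlgebra p) N']
    [Module.Finite (IwasawaAlgebra p) N] [Module.Finite (IwasawaAlgebra p) N']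
    (hN : Module.IsTorsion (IwasawaAlgebra p) N) (hN' : Module.IsTorsion (IwasawaAlgebra p) N')
    {f : ℤ_[p][X]} (hf : f.IsDistinguishedAt (IsLocalRing.maximalIdeal ℤ_[p])) (hirr : Irreducible f) {k : ℕ}
    (h : ∃ C m₀ : ℕ, ∀ m : ℕ, m₀ ≤ m →
      Nat.card (N ⧸ (Ideal.span {(f : IwasawaAlgebra p) + PowerSeries.C ((p : ℤ_[p]) ^ m)} • ⊤ :
        Submodule (IwasawaAlgebra p) N)) ≤
      p ^ C * Nat.card (N' ⧸ (Ideal.span {(f : IwasawaAlgebra p) + PowerSeries.C ((p : ℤ_[p]) ^ m)} • ⊤ :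
        Submodule (IwasawaAlgebra p) N')) ^ k)
    (𝔭 : PrimeSpectrum (IwasawaAlgebra p)) (h𝔭 : 𝔭.asIdeal = Ideal.span {(f : IwasawaAlgebra p)}) :
    Module.lengthAt (IwasawaAlgebra p) N 𝔭 ≤ k * Module.lengthAt (IwasawaAlgebra p) N' 𝔭 := by
  have hp : p.Prime := Fact.out
  have hd := natDegree_pos_of_irreducible p hf hirr
  obtain ⟨C, m₀, hC⟩ := h
  obtain ⟨B, m₁, -, h1⟩ := exists_card_quotSMulTop_add_C_pow_bounds p N hN hf hirr 𝔭 h𝔭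
  obtain ⟨B', m₂, -, h2⟩ := exists_card_quotSMulTop_add_C_pow_bounds p N' hN' hf hirr 𝔭 h𝔭
  set ℓ := (Module.lengthAt (IwasawaAlgebra p) N 𝔭).toNat with hℓ
  set ℓ' := (Module.lengthAt (IwasawaAlgebra p) N' 𝔭).toNat with hℓ'
  have hnat : f.natDegree * ℓ ≤ f.natDegree * (k * ℓ') := by
    refine le_of_forall_pow_mul_le hp.one_lt (D := B * p ^ C * B' ^ k) (m₀ := max m₀ (max m₁ m₂)) fun m hm => ?_
    have hm0 : m₀ ≤ m := le_trans (le_max_left _ _) hm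
    have hm1 : m₁ ≤ m := le_trans (le_trans (le_max_left _ _) (le_max_right _ _)) hm
    have hm2 : m₂ ≤ m := le_trans (le_trans (le_max_right _ _) (le_max_right _ _)) hm
    obtain ⟨-, hlow, -⟩ := h1 m hm1
    obtain ⟨-, -, hup⟩ := h2 m hm2
    calc p ^ (m * (f.natDegree * ℓ)) ≤ B * Nat.card (N ⧸ _) := hlow
      _ ≤ B * (p ^ C * Nat.card (N' ⧸ _) ^ k) := Nat.mul_le_mul_left _ (hC m hm0)
      _ ≤ B * (p ^ C * (B' * p ^ (m * (f.natDegree * ℓ'))) ^ k) := by gcongr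
      _ = B * p ^ C * B' ^ k * p ^ (m * (f.natDegree * (k * ℓ'))) := by
          rw [mul_pow, ← pow_mul]; ring_nf
  have hnat' : ℓ ≤ k * ℓ' := Nat.le_of_mul_le_mul_left hnat hd
  have h1' : 𝔭.asIdeal.height = 1 := by
    rw [h𝔭]; exact Module.height_span_singleton_eq_one_of_prime (prime_coe_of_irreducible p hf hirr)
  have hN1 := lengthAt_ne_top_of_isTorsion_of_height_le_one p N hN 𝔭 h1'.le
  have hN2 := lengthAt_ne_top_of_isTorsion_of_height_le_one p N' hN' 𝔭 h1'.le
  rw [← ENat.coe_toNat hN1, ← ENat.coe_toNat hN2]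
  exact_mod_cast hnat'

end IwasawaAlgebra

end Literature.NumberTheory.EllipticCurves

end
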